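import Summits.BirchSwinnertonDyer.Rank1Residual.GaloisImage.NineTorsionScalarStabiliserTower
import Summits.BirchSwinnertonDyer.Rank1Residual.GaloisImage.HauptmodulNineValuationThree
import Summits.BirchSwinnertonDyer.Rank1Residual.GaloisImage.HauptmodulThreeShapeValuation
import Summits.BirchSwinnertonDyer.Rank1Residual.GaloisImage.HauptmodulNineInvariant
import HarnessLib

/-!
# The `3`-adic tower on the EXOTIC core at `v₃(j) = 3`, `j/27 ≡ 5 (mod 9)`: `ρ̄_{E,3}` onto implies
# `ρ̄_{E,3ⁿ}` onto for every `n` — via the level-`9` Hauptmodul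
# (cell `b2b-bsdres`, team n1011, seat p02 gen 5 — row T-b11-F4 'scalar-stabiliser tower criterion
# at 9', file F4c-H11: the assembly of the Hauptmodul route for the sub-family `j/27 ≡ 5 (mod 9)`)

HONEST FRAMING (cell `b2b-bsdres`, run/shared/lean/b2b/bsd-rank1-residual/, verbatim in every
file): the goal of the cell is to DELETE the COMBINATION-SHAPED residual classes of the
Birch–Swinnerton-Dyer formula for ALL analytic-rank `≤ 1` elliptic curves over `ℚ` — "full BSD
formula for every rank `≤ 1` curve in class `C`" assembled STRICTLY from published theorems — so
that the rank-`≤ 1` remainder becomes exactly the CONSTRUCTION-SHAPED classes, which are TYPED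
(missing-input `Prop`s), NOT attempted. This is not "finishing BSD". Team n1011 (N10 / N11):
research route; no claim beyond the stated classes; labels UNCHANGED; nothing is booked. Theorems
only (no definition, no named fact).

## What this file proves

* `padicValRat_j_sub_1728_of_nine_dvd_num` — `9 ∣ num(j/27 − 5)` ⟹ `v₃(j − 1728) = 3`
  (`j − 1728 = 27((j/27 − 5) − 59)`).
* **`towerSurj_three_of_surj_of_nine_dvd_num`** — for `E/ℚ` with `ρ̄_{E,3}` onto and
  `9 ∣ num(j(E)/27 − 5)` (i.e. `v₃(j) = 3`, `j/27 ≡ 5 (mod 9)`): `ρ̄_{E,3ⁿ}` is onto for every `n`.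
  As in `HauptmodulNineTower`, with the invariant `z = (3θ/(θ³ − 3))² − 1` of valuation `2/9`
  (`HauptmodulNineValuationThree`: `v(z)⁹ = v(3)²`; `9` is coprime to `0 − 2`).
* `imageContainsSL2_three_of_surj_of_nine_dvd_num` — Kato's (12.5.2) at `p = 3`.

This discharges by a KERNEL PROOF the third family of the EXOTIC core of the cell's `3`-adic census
(`v₃(j) = 3`, `j/27 ≡ 5 (mod 9)`: 84 of the 749 `m = 3` cells; EVIDENCE kit j134538).  With
`HauptmodulNineTower` (142) and `HauptmodulNineTowerFive` (117) the Hauptmodul route covers 343 of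
the 749 cells; the classes `j/27 ≡ 8 (mod 9)` (27 cells) and `v₃(j) ≥ 6` (379 cells) are NOT
claimed — there the three level-`9` invariants used so far are `3`-adic units or have integral
valuation.  Nothing booked; no label change.

References: [Maier2006] Table 4 (N = 3, 9), §5; [SerreAbelianLadic1968] IV-23;
[SerreLocalFields1979] Ch. I §7; [Kato2004Asterisque] (12.5.2).
-/

noncomputable section

set_option maxRecDepth 10000

open scoped Classical

open WeierstrassCurve Field

namespace Summit.BirchSwinnertonDyer.Rank1Residual.GaloisImage

open Literature.NumberTheory.EllipticCurves Literature.NumberTheory.GaloisRepresentations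
  Rat.HeightOneSpectrum

variable (W : WeierstrassCurve ℚ) [W.IsElliptic]

/-- `9 ∣ num(j/27 − 5) ⟹ v₃(j − 1728) = 3`: `j − 1728 = 27·((j/27 − 5) − 59)` with
`v₃((j/27 − 5) − 59) = 0`. [folklore] -/
theorem padicValRat_j_sub_1728_of_nine_dvd_num (hj5 : (9 : ℤ) ∣ (W.j / 27 - 5).num) :
    padicValRat 3 (W.j - 1728) = ((3 : ℕ) : ℤ) := by
  haveI : Fact (Nat.Prime 3) := ⟨Nat.prime_three⟩
  have h59 : padicValRat 3 (-59 : ℚ) = 0 := by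
    rw [padicValRat.neg, show (59 : ℚ) = ((59 : ℕ) : ℚ) by norm_num, padicValRat.of_nat,
      padicValNat.eq_zero_of_not_dvd (by norm_num)]
    rfl
  have hne' : -59 + (W.j / 27 - 5) ≠ 0 := by
    intro h0
    have e59 : W.j / 27 - 5 = 59 := by linear_combination h0
    have h2 : (9 : ℤ) ∣ (59 : ℚ).num := by rw [← e59]; exact hj5
    norm_num at h2
  have hr : padicValRat 3 (-59 + (W.j / 27 - 5)) = 0 := by
    by_cases hq : W.j / 27 - 5 = 0
    · rw [hq, add_zero, h59]
    have h2 := two_le_padicValRat_of_nine_dvd_num hq hj5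
    rw [padicValRat.add_eq_min hne' (by norm_num) hq (by rw [h59]; omega), h59]
    exact min_eq_left (by omega)
  have e : W.j - 1728 = 27 * (-59 + (W.j / 27 - 5)) := by ring
  have h27 : padicValRat 3 (27 : ℚ) = 3 := by
    have h33 : padicValRat 3 (3 : ℚ) = 1 := by exact_mod_cast padicValRat.self (p := 3) (by norm_num)
    rw [show (27 : ℚ) = 3 ^ 3 by norm_num, padicValRat.pow, h33]
    all_goals norm_num
  rw [e, padicValRat.mul (by norm_num) hne', h27, hr]
  rfl

/-- **THE TOWER AT `j/27 ≡ 5 (mod 9)`.**  For `E/ℚ` with `ρ̄_{E,3}` onto and `9 ∣ num(j/27 − 5)`,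
`ρ̄_{E,3ⁿ}` is onto for every `n` (level-`9` Hauptmodul: the `Stab(ℤQ)`-invariant
`z = (3θ/(θ³ − 3))² − 1 ∈ ℚ(E[9])`, `θ = η(E, ℤQ) + 3`, has `3`-adic valuation exactly `2/9`;
scalar-stabiliser tower criterion). [cite: SerreAbelianLadic1968, Ch. IV §3.4, Lemma 3 (IV-23)]
[cite: Maier2006, Table 4 (N = 9) and §5] -/
theorem towerSurj_three_of_surj_of_nine_dvd_num (hsurj : W.HasSurjectiveModNGaloisRep 3)
    (hj5 : (9 : ℤ) ∣ (W.j / 27 - 5).num) (n : ℕ) : W.HasSurjectiveModNGaloisRep (3 ^ n : ℕ) := by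
  haveI : Fact (Nat.Prime 3) := ⟨Nat.prime_three⟩
  set v := (placeOver 3).valuation with hv
  set t := v (3 : AlgebraicClosure ℚ) with ht
  have ht0 : t ≠ 0 := valuation_three_ne_zero
  -- (1) a `9`-torsion point above a non-canonical `3`-torsion point, `v(S(3Q))³ = t³`
  have hj3 := padicValRat_j_sub_1728_of_nine_dvd_num W hj5
  obtain ⟨Q, x₃, y₃, h₃, hQ9, hQ3, -, hvalS⟩ :=
    exists_nineTorsion_hauptmodul_three_valuation W (m := 3) (by norm_num) (by norm_num) hj3
  have h3Q : (3 ^ 1 : ℕ) • Q ≠ 0 := by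
    rw [pow_one, ← natCast_zsmul, Nat.cast_ofNat, hQ3]
    exact Affine.Point.some_ne_zero h₃
  have h9Q : (3 ^ (1 + 1) : ℕ) • Q = 0 := by
    rw [← natCast_zsmul]; exact_mod_cast hQ9
  have h9 : addOrderOf Q = 9 := by
    have := addOrderOf_eq_prime_pow h3Q h9Q
    norm_num at this
    exact this
  -- (2) the invariant `θ`
  obtain ⟨θ, hθL, hθfix, hjθ, hSθ⟩ := exists_hauptmodulNine_invariant W h9 hQ3
  have hSθ' : (W.map (algebraMap ℚ (AlgebraicClosure ℚ))).tgA₁ x₃ y₃ ^ 3 /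
      (W.map (algebraMap ℚ (AlgebraicClosure ℚ))).tgA₃ x₃ y₃ = θ ^ 3 := hSθ
  rw [hSθ'] at hvalS
  have hvS : v (θ ^ 3) = t := (pow_left_inj₀ zero_le zero_le three_ne_zero).mp hvalS
  -- (3) the curve-free core: `v(z)⁹ = t²`
  have hz := valuation_hauptmodul_nine_invariant_three_pow_nine hj5 hjθ hvS rfl
  have hz0 : (3 * θ / (θ ^ 3 - 3)) ^ 2 - 1 ≠ 0 := by
    intro h0
    rw [h0, map_zero, zero_pow (by norm_num)] at hz
    exact pow_ne_zero 2 ht0 hz.symm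
  -- `z ∈ ℚ(E[9])` and `z` is `Stab(ℤQ)`-invariant
  have hzL : (3 * θ / (θ ^ 3 - 3)) ^ 2 - 1 ∈ W.divisionField 9 :=
    sub_mem (pow_mem (div_mem (mul_mem (ofNat_mem _ 3) hθL)
      (sub_mem (pow_mem hθL 3) (ofNat_mem _ 3))) 2) (one_mem _)
  have hfix : ∀ σ : absoluteGaloisGroup ℚ, (∃ k : ℤ, σ • Q = k • Q) →
      σ • ((3 * θ / (θ ^ 3 - 3)) ^ 2 - 1) = (3 * θ / (θ ^ 3 - 3)) ^ 2 - 1 := by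
    intro σ hσ
    have hθ' : absoluteGaloisGroup.toAlgEquiv ℚ σ θ = θ := by
      rw [← absoluteGaloisGroup.smul_def]; exact hθfix σ hσ
    rw [absoluteGaloisGroup.smul_def]
    simp only [map_sub, map_div₀, map_mul, map_pow, map_ofNat, map_one, hθ']
  -- (4) the scalar-stabiliser tower criterion with `d = 9`, `a = 0`, `b = 2`
  have hQ₉ : Q ∈ geomTorsion W 9 := (Submodule.mem_torsionBy_iff _ _).mpr hQ9
  have hval : v ((3 * θ / (θ ^ 3 - 3)) ^ 2 - 1) ^ 9 * t ^ 0 = t ^ 2 := by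
    rw [pow_zero, mul_one]; exact hz
  have hcop : IsCoprime ((9 : ℕ) : ℤ) (((0 : ℕ) : ℤ) - ((2 : ℕ) : ℤ)) :=
    ⟨1, 4, by norm_num⟩
  exact towerSurj_three_of_surj_of_valuation_of_smul_zmultiples W hsurj hQ₉ hzL hz0 hfix hval hcop
    (dvd_refl 9) n

/-- **Kato's (12.5.2) at `p = 3` on the family `j/27 ≡ 5 (mod 9)`** from surj(3).
[cite: Kato2004Asterisque, (12.5.2) (p. 222)] [cite: SerreAbelianLadic1968, Ch. IV §3.4, Lemma 3 (IV-23)] -/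
theorem imageContainsSL2_three_of_surj_of_nine_dvd_num
    (hsurj : W.HasSurjectiveModNGaloisRep 3) (hj5 : (9 : ℤ) ∣ (W.j / 27 - 5).num) :
    Kato2004.ImageContainsSL2 W 3 := by
  haveI : Fact (Nat.Prime 3) := ⟨Nat.prime_three⟩
  exact (Kato2004.imageContainsSL2_iff_forall_hasSurjectiveModNGaloisRep W 3).mpr
    (towerSurj_three_of_surj_of_nine_dvd_num W hsurj hj5)

end Summit.BirchSwinnertonDyer.Rank1Residual.GaloisImage
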